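import Literature.NumberTheory.NumberFields.NarrowClassGroup
import Mathlib.RingTheory.ClassGroup.Basic
import HarnessLib

/-!
# The `p`-rank of the narrow class group is invariant under field isomorphisms:
# `F ≃+* F' ⟹ [Cl⁺_F : (Cl⁺_F)^p] = [Cl⁺_{F'} : (Cl⁺_{F'})^p]` (proved; no definition, no named fact)

`Proofs`-style file (theorems only) in topic `NumberTheory/NumberFields` (namespace `Literature.NumberTheory.NumberFields`), written by the
prover seat `cruxlead-stmt-BirchSwinnertonDyer-19573-w2` GEN 9 (cell `bsd-2adic`; `--supports` stmt-BirchSwinnertonDyer-19573; closes nothing).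
Transport brick of «NARROW FUKUDA» (Fukuda 1994 Thm. 1 (2) for narrow class groups, finite level): the per-layer class field theory is done
over a model `F_j ⊆ K_{n+t}` of the layer `K_{n+j}` of a `ℤ_p`-tower, and the narrow `p`-rank has to be moved back along the ring isomorphism
`F_j ≅ K_{n+j}` — the narrow companion of `ClassGroup.mulEquiv` (Mathlib) used by `Fukuda1994Thm1RankLayer`, and of GEN 8's
`narrowClassNumber_eq_of_ringEquiv` (which transports `h⁺` through `h⁺·#sign(U) = h·2^{r₁}` and leaves the group aside).

* §1 `index_range_pow_quotient_eq_index_sup` — for a commutative group `G` and `N ≤ G`: `[G/N : (G/N)^p] = [G : N·G^p]`.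
* §2 `index_range_pow_narrowClassGroup_eq_index_sup` — **`[Cl⁺_F : (Cl⁺_F)^p] = [I_F : P_F⁺ · I_F^p]`** (`I_F` the fractional ideals,
  `P_F⁺ = totPosPrincipalIdeals F`; the tree's `NarrowClassGroup F = RayClassGroup ⊤ = J^1/P^1` with `idealsPrimeTo_top`, `ray_top`).
* §3 (private: the isomorphism of fraction fields induced by `𝓞 F ≅ 𝓞 F'` IS `e`),
  `map_totPosPrincipalIdeals_eq` (`e` carries `P_F⁺` onto `P_{F'}⁺`: real embeddings correspond under `σ' ↦ σ' ∘ e`), and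
  **`index_range_pow_narrowClassGroup_eq_of_ringEquiv`**: `[Cl⁺_F : (Cl⁺_F)^p] = [Cl⁺_{F'} : (Cl⁺_{F'})^p]`.

References: [FrohlichTaylor1990] Ch. V §1 (1.7)–(1.13), pp. 163–164; [NeukirchANT1999] Ch. VI §1 Def. (1.7); [Fukuda1994] Thm. 1 (2), p. 264
(context: `rank(A_n)`).
-/

set_option autoImplicit false

noncomputable section

open scoped NumberField nonZeroDivisors
open NumberField IsDedekindDomain

namespace Literature.NumberTheory.NumberFields

open Literature.NumberTheory.GaloisRepresentations

/-! ## §1 `[G/N : (G/N)^p] = [G : N·G^p]` -/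

/-- For a commutative group `G`, a subgroup `N` and `p : ℕ`: the `p`-th powers of `G/N` are the image of the `p`-th powers of `G`, so
`[G/N : (G/N)^p] = [G : N ⊔ G^p]`. [folklore] [cite: Lang1990, Ch. 13 §2 (`C(p) = C/C^p`)] -/
theorem index_range_pow_quotient_eq_index_sup {G : Type*} [CommGroup G] (N : Subgroup G) (p : ℕ) :
    (powMonoidHom (α := G ⧸ N) p).range.index = (N ⊔ (powMonoidHom (α := G) p).range).index := by
  have hmap : (powMonoidHom (α := G ⧸ N) p).range = ((powMonoidHom (α := G) p).range).map (QuotientGroup.mk' N) := by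
    ext y
    constructor
    · rintro ⟨c, rfl⟩
      obtain ⟨g, rfl⟩ := QuotientGroup.mk'_surjective N c
      exact ⟨g ^ p, ⟨g, rfl⟩, by rw [map_pow, powMonoidHom_apply]⟩
    · rintro ⟨_, ⟨g, rfl⟩, rfl⟩
      exact ⟨QuotientGroup.mk' N g, by rw [powMonoidHom_apply, powMonoidHom_apply, map_pow]⟩
  rw [hmap, ← Subgroup.index_comap_of_surjective _ (QuotientGroup.mk'_surjective N), QuotientGroup.comap_map_mk']

/-! ## §2 `[Cl⁺_F : (Cl⁺_F)^p] = [I_F : P_F⁺ · I_F^p]` -/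

variable {F F' : Type*} [Field F] [Field F']

/-- **`[Cl⁺_F : (Cl⁺_F)^p] = [I_F : P_F⁺ · I_F^p]`**: the narrow class group is `I_F/P_F⁺` (`NarrowClassGroup F = RayClassGroup ⊤`,
`idealsPrimeTo_top`, `ray_top`), and §1. [cite: FrohlichTaylor1990, Ch. V §1 ("C_N⁺ = I_N/P_N⁺"), p. 163] [cite: NeukirchANT1999, Ch. VI §1 Def. (1.7)] -/
theorem index_range_pow_narrowClassGroup_eq_index_sup [NumberField F] (p : ℕ) :
    (powMonoidHom (α := NarrowClassGroup F) p).range.index =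
      (totPosPrincipalIdeals F ⊔ (powMonoidHom (α := (FractionalIdeal (𝓞 F)⁰ F)ˣ) p).range).index := by
  classical
  -- `Cl⁺ = ↥T ⧸ R'` with `T = J^1 = ⊤`, `R' = P⁺ ∩ T`
  set T : Subgroup (FractionalIdeal (𝓞 F)⁰ F)ˣ := idealsPrimeTo (⊤ : Ideal (𝓞 F)) with hT
  have hTtop : T = ⊤ := by rw [hT, idealsPrimeTo_top]
  have hmemT : ∀ I : (FractionalIdeal (𝓞 F)⁰ F)ˣ, I ∈ T := fun I => by rw [hTtop]; exact Subgroup.mem_top I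
  change (powMonoidHom (α := ↥T ⧸ (ray (⊤ : Ideal (𝓞 F))).subgroupOf T) p).range.index = _
  rw [index_range_pow_quotient_eq_index_sup]
  -- transfer from `↥T` to `I_F` along the subtype (an isomorphism since `T = ⊤`)
  have hinj : Function.Injective T.subtype := T.subtype_injective
  rw [← Nat.mul_one (((ray (⊤ : Ideal (𝓞 F))).subgroupOf T ⊔ (powMonoidHom (α := ↥T) p).range).index), ← Subgroup.index_top (G := (FractionalIdeal (𝓞 F)⁰ F)ˣ),
    ← hTtop, ← Subgroup.index_map_subtype, Subgroup.map_sup]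
  congr 1
  have h1 : ((ray (⊤ : Ideal (𝓞 F))).subgroupOf T).map T.subtype = totPosPrincipalIdeals F := by
    rw [← ray_top, Subgroup.map_subgroupOf_eq_of_le]
    rw [hTtop]; exact le_top
  have h2 : ((powMonoidHom (α := ↥T) p).range).map T.subtype = (powMonoidHom (α := (FractionalIdeal (𝓞 F)⁰ F)ˣ) p).range := by
    ext I
    constructor
    · rintro ⟨_, ⟨x, rfl⟩, rfl⟩
      exact ⟨(x : (FractionalIdeal (𝓞 F)⁰ F)ˣ), by rw [powMonoidHom_apply, powMonoidHom_apply, Subgroup.coe_subtype, Subgroup.coe_pow]⟩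
    · rintro ⟨J, rfl⟩
      exact ⟨⟨J, hmemT J⟩ ^ p, ⟨⟨J, hmemT J⟩, rfl⟩, by rw [powMonoidHom_apply, Subgroup.coe_subtype, Subgroup.coe_pow]⟩
  rw [h1, h2]

/-! ## §3 Transport along `e : F ≃+* F'` -/

/-- The isomorphism of fraction fields `F ≃+* F'` induced by `𝓞 F ≅ 𝓞 F'` (itself induced by `e`) is `e`. [folklore] -/
private theorem ringEquivOfRingEquiv_mapRingEquiv_apply [NumberField F] [NumberField F'] (e : F ≃+* F') (x : F) :
    IsFractionRing.ringEquivOfRingEquiv (K := F) (L := F') (RingOfIntegers.mapRingEquiv e) x = e x := by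
  have h : (IsFractionRing.ringEquivOfRingEquiv (K := F) (L := F') (RingOfIntegers.mapRingEquiv e)).toRingHom.comp
      (algebraMap (𝓞 F) F) = e.toRingHom.comp (algebraMap (𝓞 F) F) := by
    ext a
    rw [RingHom.comp_apply, RingHom.comp_apply, RingEquiv.toRingHom_eq_coe, RingEquiv.toRingHom_eq_coe, RingHom.coe_coe,
      RingHom.coe_coe, IsFractionRing.ringEquivOfRingEquiv_algebraMap]
    rfl
  have h' := IsLocalization.ringHom_ext (nonZeroDivisors (𝓞 F)) h
  have := congrArg (fun f : F →+* F' => f x) h'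
  simpa using this

/-- **`e` carries the totally positive elements of `F` onto those of `F'`** (the real embeddings of `F'` are the `σ ∘ e⁻¹`).
[cite: FrohlichTaylor1990, Ch. V §1 (1.11), p. 164] -/
theorem map_ker_signHom_eq [NumberField F] [NumberField F'] (e : F ≃+* F') :
    ((signHom F).ker).map (Units.mapEquiv e.toMulEquiv).toMonoidHom = (signHom F').ker := by
  ext y
  constructor
  · rintro ⟨x, hx, rfl⟩
    have hx' := (mem_ker_signHom_iff F).mp (SetLike.mem_coe.mp hx)
    rw [mem_ker_signHom_iff]
    intro σ'
    have h := hx' (σ'.comp e.toRingHom)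
    simpa using h
  · intro hy
    rw [mem_ker_signHom_iff] at hy
    refine ⟨Units.mapEquiv e.symm.toMulEquiv y, ?_, ?_⟩
    · rw [SetLike.mem_coe, mem_ker_signHom_iff]
      intro σ
      have h := hy (σ.comp e.symm.toRingHom)
      simpa using h
    · ext
      simp

/-- **`e` carries `P_F⁺` onto `P_{F'}⁺`** under the induced isomorphism of the groups of fractional ideals.
[cite: FrohlichTaylor1990, Ch. V §1 ("P_N⁺"), p. 163] -/
theorem map_totPosPrincipalIdeals_eq [NumberField F] [NumberField F'] (e : F ≃+* F') :
    (totPosPrincipalIdeals F).map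
        (Units.mapEquiv (FractionalIdeal.ringEquivOfRingEquiv F F' (RingOfIntegers.mapRingEquiv e)).toMulEquiv).toMonoidHom =
      totPosPrincipalIdeals F' := by
  classical
  have key : ∀ x : Fˣ,
      (Units.mapEquiv (FractionalIdeal.ringEquivOfRingEquiv F F' (RingOfIntegers.mapRingEquiv e)).toMulEquiv).toMonoidHom
          (toPrincipalIdeal (𝓞 F) F x) =
        toPrincipalIdeal (𝓞 F') F' (Units.mapEquiv e.toMulEquiv x) := by
    intro x
    symm
    rw [toPrincipalIdeal_eq_iff]
    simp only [MulEquiv.coe_toMonoidHom, Units.coe_mapEquiv, RingEquiv.toMulEquiv_eq_coe, RingEquiv.coe_toMulEquiv,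
      coe_toPrincipalIdeal, FractionalIdeal.ringEquivOfRingEquiv_spanSingleton, ringEquivOfRingEquiv_mapRingEquiv_apply]
  unfold totPosPrincipalIdeals
  rw [← map_ker_signHom_eq e, Subgroup.map_map, Subgroup.map_map]
  congr 1
  refine MonoidHom.ext fun x => ?_
  rw [MonoidHom.comp_apply, MonoidHom.comp_apply]
  exact key x

/-- The induced isomorphism of the groups of fractional ideals carries `I_F^p` onto `I_{F'}^p`. [folklore] -/
private theorem map_range_pow_units_fractionalIdeal_eq [NumberField F] [NumberField F'] (e : F ≃+* F') (p : ℕ) :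
    ((powMonoidHom (α := (FractionalIdeal (𝓞 F)⁰ F)ˣ) p).range).map
        (Units.mapEquiv (FractionalIdeal.ringEquivOfRingEquiv F F' (RingOfIntegers.mapRingEquiv e)).toMulEquiv).toMonoidHom =
      (powMonoidHom (α := (FractionalIdeal (𝓞 F')⁰ F')ˣ) p).range := by
  ext J
  constructor
  · rintro ⟨_, ⟨I, rfl⟩, rfl⟩
    exact ⟨(Units.mapEquiv (FractionalIdeal.ringEquivOfRingEquiv F F' (RingOfIntegers.mapRingEquiv e)).toMulEquiv).toMonoidHom I,
      by rw [powMonoidHom_apply, powMonoidHom_apply, map_pow]⟩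
  · rintro ⟨I, rfl⟩
    obtain ⟨I₀, rfl⟩ := (Units.mapEquiv (FractionalIdeal.ringEquivOfRingEquiv F F' (RingOfIntegers.mapRingEquiv e)).toMulEquiv).surjective I
    exact ⟨I₀ ^ p, ⟨I₀, rfl⟩, by rw [powMonoidHom_apply, MulEquiv.coe_toMonoidHom, map_pow]⟩

/-- **The narrow `p`-rank is invariant under field isomorphisms: `[Cl⁺_F : (Cl⁺_F)^p] = [Cl⁺_{F'} : (Cl⁺_{F'})^p]`** along
`e : F ≃+* F'` (§2 on both sides, and the induced isomorphism `I_F ≅ I_{F'}` carries `P_F⁺·I_F^p` onto `P_{F'}⁺·I_{F'}^p`).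
[cite: FrohlichTaylor1990, Ch. V §1 (1.7)–(1.13), pp. 163–164] [cite: Fukuda1994, Thm. 1 (2), p. 264 (the `p`-rank `rank(A_n)`)] -/
theorem index_range_pow_narrowClassGroup_eq_of_ringEquiv [NumberField F] [NumberField F'] (e : F ≃+* F') (p : ℕ) :
    (powMonoidHom (α := NarrowClassGroup F) p).range.index = (powMonoidHom (α := NarrowClassGroup F') p).range.index := by
  rw [index_range_pow_narrowClassGroup_eq_index_sup, index_range_pow_narrowClassGroup_eq_index_sup,
    ← Subgroup.index_map_equiv (H := totPosPrincipalIdeals F ⊔ (powMonoidHom (α := (FractionalIdeal (𝓞 F)⁰ F)ˣ) p).range)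
      (e := Units.mapEquiv (FractionalIdeal.ringEquivOfRingEquiv F F' (RingOfIntegers.mapRingEquiv e)).toMulEquiv)]
  congr 1
  rw [show ((Units.mapEquiv (FractionalIdeal.ringEquivOfRingEquiv F F' (RingOfIntegers.mapRingEquiv e)).toMulEquiv :
      (FractionalIdeal (𝓞 F)⁰ F)ˣ ≃* (FractionalIdeal (𝓞 F')⁰ F')ˣ) : (FractionalIdeal (𝓞 F)⁰ F)ˣ →* (FractionalIdeal (𝓞 F')⁰ F')ˣ) =
      (Units.mapEquiv (FractionalIdeal.ringEquivOfRingEquiv F F' (RingOfIntegers.mapRingEquiv e)).toMulEquiv).toMonoidHom from rfl,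
    Subgroup.map_sup, map_totPosPrincipalIdeals_eq, map_range_pow_units_fractionalIdeal_eq]

/-- `ord_p [Cl⁺_F : (Cl⁺_F)^p] = ord_p [Cl⁺_{F'} : (Cl⁺_{F'})^p]` along `e : F ≃+* F'`. [cite: FrohlichTaylor1990, Ch. V §1, p. 163] -/
theorem padicValNat_index_range_pow_narrowClassGroup_eq_of_ringEquiv [NumberField F] [NumberField F'] (e : F ≃+* F') (p : ℕ) :
    padicValNat p (powMonoidHom (α := NarrowClassGroup F) p).range.index =
      padicValNat p (powMonoidHom (α := NarrowClassGroup F') p).range.index := by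
  rw [index_range_pow_narrowClassGroup_eq_of_ringEquiv e p]

end Literature.NumberTheory.NumberFields

end
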